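import Mathlib.Topology.MetricSpace.HausdorffDistance
import Mathlib.Analysis.SpecialFunctions.Pow.Real
import Literature.Probability.RandomPlanarGeometry.Curve
import Literature.Probability.RandomPlanarGeometry.CurveSpace
import Literature.Probability.RandomPlanarGeometry.PlanarDomains
import Literature.Probability.RandomPlanarGeometry.SLE
import Literature.Probability.LatticeModels.LatticeGraph
import Literature.Probability.LatticeModels.IsingModel
import Literature.Probability.LatticeModels.DomainDiscretisation
import Literature.Probability.Percolation.Crossings
import Literature.Probability.LatticeModels.RandomCluster
import Literature.Probability.LatticeModels.LatticeInterface
import Literature.Probability.LatticeModels.MedialInterface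
import Literature.Probability.LatticeModels.FermionicObservable
import Literature.Probability.LatticeModels.PlanarIsing
import HarnessLib

-- provenance: harness21/H21/H21/Statements/CritIsing/InterfaceSLE.lean @ 92e087e (interim HEAD d8f2665); M5 mechanical rewrite
/-!
# Critical Ising and FK-Ising interfaces converge to SLE₃ and SLE_{16/3}

Trunk `Stoch` (G15), family `crit-ising`, statement file `Statements/CritIsing/InterfaceSLE.lean`,
id **crit-ising.S17**:

> at `β_c` on discretisations `(Ω_δ; a_δ, b_δ)` of a Jordan domain `(Ω; a, b)` with Dobrushin
> `±` boundary conditions, the spin-Ising interface from `a` to `b` converges in law (curves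
> modulo reparametrisation) to chordal SLE₃, and the FK-Ising (random-cluster `q = 2`)
> interface to SLE_{16/3}.

Source: D. Chelkak, H. Duminil-Copin, C. Hongler, A. Kemppainen, S. Smirnov (CDHKS), *Convergence
of Ising interfaces to Schramm's SLE curves*, C. R. Math. Acad. Sci. Paris 352 (2014) 157–161,
Theorems 1 and 2; S. Smirnov, *Conformal invariance in random cluster models. I*, Ann. Math. 172
(2010) 1435–1467 (fermionic observable, FK interface).

## Contents (namespace `Literature.CritIsing`)

* `dobrushinData D δ : DiscreteDobrushin` — the *canonical* G02 Dobrushin data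
  `⟨Ω, δ, (ab), (ba)⟩` of a T-STOCH Dobrushin domain `(D; a, b)` (consumed by
  `Statements/CritIsing/Sweep1`, crit-ising.S18). It is one candidate discretisation, not the
  one forced on the S17 statements (see "Discretisations" below).
* `dobrushinBC E : SpinConfig (Site 2)` — the `±` boundary spins of discrete Dobrushin data `E`:
  `+1` exactly on G02's discrete arc `E.zdArcA`, `−1` elsewhere.
* `isingDobrushinMeasure E β` — the Ising measure of `Ω_δ = discreteDomainGraph E.Ω E.δ` in the
  volume `Ω_δ ∖ ∂Ω_δ` (`meshInteriorFinset`, as in `Statements/CritIsing/PlanarIsing`) at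
  inverse temperature `β`, `h = 0`, boundary condition `.fixed (dobrushinBC E)`.
* `fkDobrushinMeasure E` — the critical FK-Ising measure seen by G02's FK interface,
  `E.fkInterfaceMeasure p_c 2` (`p_c = criticalFKIsingParam = √2/(1+√2)`; arc `A` wired, the
  edges touching arc `B` deleted = dual-wired), `Fintype` instance from `meshDomain_finite`.
* `orientChord`, `spinInterfaceCurve D δ γ`, `fkInterfaceCurve D E ω : CurveClass ℂ` —
  interfaces as curves modulo reparametrisation, oriented from `a` to `b`.
* `IsDiscretisation D E` — the hypothesis structure "the discrete Dobrushin data `E δ`,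
  `δ > 0`, discretise `(D; a, b)`": domain `D.carrier`, mesh `δ`, arcs `→ (ab), (ba)` and
  discrete marked points `a_δ, b_δ → a, b` in Hausdorff distance, admissible for all small `δ`.
* **crit-ising.S17**: `convergesInLawToSLE_sixteen_thirds_fkInterface` (Theorem 2, live named
  fact) and `convergesInLawToSLE_three_isingInterface` (Theorem 1) — the latter a **misstated
  rendering, now a `@[deprecated]` record and no longer literature debt**; the faithful
  transcription of Theorem 1 is
  `Literature.Probability.LatticeModels.convergesInLawToSLE_three_isingInterface_zd`
  (`InterfaceSLEProofs.lean`). See "Misstated rendering of Theorem 1" below.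

The companion statement crit-ising.S18 (convergence of the fermionic observable to `√Φ'`) is
G02's statement (item `FermionicObservable`; stated in `Statements/CritIsing/Sweep1`) and
consumes the T-STOCH `ConformalEquiv`, `MarkedDomain.IsChordalUniformizing` and Mathlib's
`deriv`; it is not restated here.

## Design choices

* **Discretisations are quantified, not hard-wired.** CDHKS Theorems 1–2 concern families of
  discrete Dobrushin domains `(Ω_δ; a_δ, b_δ)` approximating `(Ω; a, b)`. The previous version
  hard-wired the single family `dobrushinData D δ` (continuum arcs `(ab)`, `(ba)` as the two
  arcs of the data) under the hypothesis `∀ᶠ δ, (dobrushinData D δ).IsZdAdmissible`; since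
  G02's `discreteArc` sends a boundary site equidistant from the two arcs to *both* discrete
  arcs while `IsZdAdmissible.disjoint` forbids this, that hypothesis fails on the library's own
  `DobrushinDomain.unitDisc` for every `δ` (review r02345B, item 1), making the statements
  vacuous there. Both S17 statements now take a family `E : ℝ → DiscreteDobrushin` together
  with `IsDiscretisation D E`: `(E δ).Ω = D.carrier`, `(E δ).δ = δ`, the arcs `(E δ).arcA`,
  `(E δ).arcB` (free, e.g. `(ba)` shrunk slightly away from `a`, `b` and perturbed off the
  finitely many tie sites) converge to `(ab)`, `(ba)` in the Hausdorff extended distance, the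
  discrete marked points (midpoints of the two `A`–`B` boundary edges `e_a`, `e_b`,
  `DiscreteDobrushin.zdABEdges`) converge to `{a, b}`, and `E δ` is `IsZdAdmissible` for all
  small `δ > 0`. This is the specialisation of CDHKS's Carathéodory approximation to the
  canonical vertex set `Ω_δ = meshDomain Ω δ` with converging boundary conditions; H21 has no
  Carathéodory convergence of marked domains, and fixing `Ω_δ` avoids it.
* **G02's admissibility and the polygonal boundary (history).** An earlier `MedialInterface`
  drew the discrete arcs from the vertex boundary `meshBoundary Ω δ` (sites of `Ω_δ` with a
  `ℤ²`-neighbour not `Ω_δ`-adjacent); since `IsZdAdmissible.arcs_cover_faceBoundary` asks both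
  endpoints of every edge shared by an inner and a non-inner face to lie on the arcs, and a
  *concave lattice corner* of `Ω_δ` (a site whose four neighbours are joined to it in `Ω_δ`
  while one of its four faces is not inner, e.g. `(k, k)` in the discretised disc when
  `(k+1, k+1)` falls outside) is such an endpoint outside `meshBoundary`, admissibility then
  failed for every curved domain. G02 has since enlarged the boundary: the arcs `zdArcA`,
  `zdArcB` are cut out of the *polygonal* boundary
  `DiscreteDobrushin.zdBoundary = meshBoundary ∪ {endpoints of face-boundary edges}` (the
  vertices of the topological boundary of the union of the inner faces, CDHKS's `∂Ω^δ`;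
  `MedialInterface.lean`, "Why not `meshBoundary`"), which contains the concave corners, and
  `IsDiscretisation` is satisfiable (`UnitDiscDiscretisation.lean`: `isDiscretisation_discData`,
  `exists_isDiscretisation` for the unit disc). The spin statement of this file did not follow
  that enlargement — see the next item and "Misstated rendering of Theorem 1".
* **Volume and boundary condition (as defined here; defective for the spin statement).**
  Following `PlanarIsing.lean` (CHI), `isingDobrushinMeasure` puts the free spins on
  `Ω_δ ∖ meshBoundary Ω δ = meshInteriorFinset Ω δ`, on the graph `discreteDomainGraph Ω δ`
  (no edges leave `Ω_δ`), all other spins frozen to `dobrushinBC E = +1` on `zdArcA`, `−1`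
  elsewhere. G02's `DiscreteDobrushin.IsPlus`/`IsMinus`, through which `IsDobrushinInterface`
  reads a configuration, override the spins on `zdArcA` (to `+`) and on `zdArcB` (to `−`), and
  under admissibility `zdArcA ⊔ zdArcB = zdBoundary ⊇ meshBoundary`
  (`IsZdAdmissible.zdArcA_union_zdArcB`), with equality only when `Ω_δ` has no concave lattice
  corner. So the frozen spins of `isingDobrushinMeasure` agree with the `±` completion on
  `meshBoundary`, but the sites of `zdBoundary ∖ meshBoundary` carry *thermal* spins which the
  interface predicate reads as frozen `±`. The CDHKS-faithful volume is `Ω_δ ∖ zdBoundary`: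
  `Literature.Probability.LatticeModels.zdInteriorFinset` / `isingZdDobrushinMeasure` of
  `InterfaceSLEProofs.lean` (there: `isPlus_iff_eq_one` — with that volume the completed spins
  are the sampled spins at every site, almost surely — and
  `isingZdDobrushinMeasure_eq_isingDobrushinMeasure` — the two measures coincide when
  `zdBoundary ⊆ meshBoundary`). Junk: for unbounded `Ω` or `δ ≤ 0` the volume is `∅`
  (`isingMeasure` is then a Dirac mass) and `fkDobrushinMeasure E = Measure.dirac ∅`.
* **FK measure.** G02 offers two renderings: `fkDomainMeasure Ω δ p q A` (arc `B` genuinely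
  free) and `DiscreteDobrushin.fkInterfaceMeasure` (edges touching the discrete arc `B`
  deleted, i.e. `B` dual-wired together with the outside), and documents the latter as the
  measure under which `fkInterface E ω` (which explores `E.bcBondConfig ω`) has exactly the law
  of Smirnov's FK Dobrushin interface. We use `fkInterfaceMeasure` (the outline's
  `fkDomainMeasure` differs only along `(ba)` and has the same scaling limit; review item 3).
* **Critical parameters.** `β_c = criticalBetaTwo = log (1 + √2) / 2`
  (`Statements/CritIsing/PlanarIsing`; no third name), `p_c = criticalFKIsingParam`
  (`= fkIsingParam β_c`, `fkIsingParam_half_log`), `q = 2`.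
* **Interfaces as points of `CurveClass ℂ`.** A spin interface is a list `γ` of dual edges
  (`IsDobrushinInterface`); its polyline goes through `dualMedialPoint δ d`, the midpoint of the
  true dual edge `d`, equal for adjacent faces to the midpoint of the crossed primal edge
  (G02's convention, `dualEdge_dualDartEdge`). An FK interface is G02's `fkInterface` (a list
  of medial vertices = primal edges) drawn through `medialPoint δ`. The dyadic `Path.trans`
  parametrisation of `polyline` is irrelevant in `CurveClass ℂ` (curves modulo
  reparametrisation).
* **Orientation (`orientChord`).** G02 orients interfaces by "arc `A` on the left", while
  `MarkedDomain` does not fix the orientation of the boundary loop (`Prelude/Stoch/PlanarDomains`,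
  D4), whereas chordal SLE in `IsSLECurve κ D` runs from `D.pt 0 = a` to `D.pt 1 = b` and
  `CurveClass` remembers orientation. We re-orient every discrete interface by the endpoint
  rule (reverse unless the head is at least as close to `a` as to `b`); as the interface joins
  `e_a` to `e_b` and `IsDiscretisation.tendsto_zdABEdges` gives `a_δ → a`, `b_δ → b`, this is
  the `a → b` orientation for all small `δ`.
* **Selection rule.** Where four alternating spins meet, the spin interface is not unique;
  CDHKS fix "an arbitrary deterministic procedure" (a local rule at each ambiguous face). We
  quantify over all of G02's `IsInterfaceSelection` maps, including non-local ones — a mild,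
  folklore-true strengthening (every interface is sandwiched between the leftmost and rightmost
  ones), flagged in the docstring (review item 2; outline Stoch.md St6).

## Misstated rendering of Theorem 1 (provefact verdict; verdict clean-up 2026-08-16)

`convergesInLawToSLE_three_isingInterface` is NOT a faithful rendering of CDHKS Theorem 1 and
is not to be discharged as stated; it is kept byte-for-byte, `@[deprecated]`, and is no longer
literature debt (no `…_holds` is to be expected). Findings, with the sources re-read for the
clean-up (CDHKS = arXiv:1312.0533, its page numbers; CS12 = Chelkak–Smirnov, Invent. Math. 189
(2012) 515 = arXiv:0910.2045):

1. *Print.* CDHKS §1 (p. 3): `Ω^δ ⊂ δℤ²` a simply connected approximation of `Ω`, `a^δ`,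
   `b^δ` "two vertices near `a` and `b` on the boundary `∂Ω^δ`", which cut `∂Ω^δ` into the arcs
   `(a^δ b^δ)`, `(b^δ a^δ)`; "the boundary conditions `−1` on `(a^δ b^δ)` and `+1` on
   `(b^δ a^δ)` are called Dobrushin boundary conditions … These boundary conditions generate a
   spin interface `γ^δ` … that has spins `+1` on its left side and spins `−1` on its right";
   §2 (p. 5): `Ω^δ_ℂ` is "the polygonal domain (union of tiles) corresponding to `Ω^δ`".
   CS12 §2.2.1 (arXiv p. 10), the model CDHKS §3 imports: "To each inner vertex
   `w ∈ Int Ω^δ` we assign the spin `σ(w)` … We also impose Dobrushin boundary conditions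
   assigning the `−` spins to vertices on the boundary arc `(a^δ b^δ)` and the `+` spins on the
   boundary arc `(b^δ a^δ)`". So the spins are free exactly on the inner vertices, every vertex
   of `∂Ω^δ` is frozen, and `γ^δ` is an interface of the sampled configuration.
2. *Tree.* The def couples `isingDobrushinMeasure (E δ) β_c` — free volume
   `meshInteriorFinset = Ω_δ ∖ meshBoundary` (previous design item) — with curves `sel δ σ`
   constrained only through `IsInterfaceSelection (E δ) (sel δ)`, i.e. through
   `IsDobrushinInterface`, whose darts keep `DiscreteDobrushin.IsPlus σ` on the left and
   `IsMinus σ` on the right; these predicates read every site of `zdArcA` as `+` and every site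
   of `zdArcB` as `−` whatever `σ` says there, and admissibility (part of `IsDiscretisation`, for
   all small `δ`) gives `zdArcA ⊔ zdArcB = zdBoundary = meshBoundary ∪ {endpoints of
   face-boundary edges}` (`MedialInterface.lean`). At a concave lattice corner `x` of `Ω_δ` —
   all four `ℤ²`-neighbours `Ω_δ`-adjacent to `x`, so `x ∉ meshBoundary`, but `x` a corner of a
   non-inner face, so `x ∈ zdBoundary` — the measure samples `σ x` thermally (it interacts with
   its four neighbours) while the predicate treats `x` as a frozen boundary spin. Every
   discretisation of a curved Jordan domain has such corners at all small meshes (e.g. the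
   last site of a lattice row of the discretised unit disc below a strictly shorter row). Hence
   the selected curve is a domain wall of the configuration *overridden* to `±` on `zdBoundary`,
   whose law is that of a model with annealed corner spins — not the interface of the critical
   Ising model with Dobrushin boundary conditions on `∂Ω^δ` of print. (Whether this variant has
   the same scaling limit is plausible by boundary universality but is not a published theorem,
   and in any case not CDHKS Theorem 1.) The earlier wording of this docstring ("under
   admissibility `∂Ω_δ = zdArcA ⊔ zdArcB`, so this is literally G02's `±` completion") described
   the pre-enlargement `MedialInterface` and went stale when G02 moved the arcs to `zdBoundary`.
3. *Corrected statement — already vendored, nothing new needed here.*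
   `Literature.Probability.LatticeModels.convergesInLawToSLE_three_isingInterface_zd`
   (`InterfaceSLEProofs.lean`, [CDHKSCRAS2014, Thm. 1]): the same Jordan domain, the same
   discretisations `IsDiscretisation D E`, the same curve map `spinInterfaceCurve`, but the
   measure `isingZdDobrushinMeasure (E δ) criticalBetaTwo` (free volume `Ω_δ ∖ zdBoundary`,
   `dobrushinBC` frozen on all of `zdBoundary`) and — since the 2026-08-15 review recorded in
   that file — the leftmost interface `leftmostInterface (E δ) σ` of CS12 §2.2.1 / CDHKS §1
   ("We assume `γ^δ` to be the rightmost (or the leftmost) interface") instead of an arbitrary,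
   possibly non-local, selection rule. It is reduced there by theorems to the two halves of the
   printed proof (tightness, CDHKS §2; identification, CDHKS §3). That file imports this one, so
   the corrected statement can neither be re-declared here (duplicate name) nor be named as the
   identifier target of the `deprecated` attribute, which therefore names it in its message.
   The record's one Lean-level user, the instance
   `convergesInLawToSLE_isingInterface_unitDisc` of `UnitDiscDiscretisation.lean` (the old
   statement specialised to the unit-disc discretisation), names it under
   `set_option linter.deprecated false in`. `isingDobrushinMeasure` itself stays (a definition,
   not debt; used by that instance and by the comparison lemma
   `isingZdDobrushinMeasure_eq_isingDobrushinMeasure`), with its docstring now carrying the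
   caveat.

## Mathlib

Used, not redefined: `Metric.hausdorffEDist`, `Metric.infDist`
(`Mathlib.Topology.MetricSpace.HausdorffDistance`), `MeasureTheory.Measure.dirac`,
`Set.Finite.fintype`, `SeparationQuotient` (via `CurveClass`), `nhdsWithin`/`Filter.Eventually`/
`Filter.Tendsto`, `NNReal`, `ENNReal`. Mathlib has no Ising model, random-cluster model, lattice
interface or SLE (grep `Ising`, `randomCluster`, `Loewner`, `SLE`: nothing relevant); all of
these come from the H21 preludes G02 (`Literature.Prelude.StatMech.*`) and G15 (`Literature.Prelude.Stoch.*`)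
and are not redefined here. `dobrushinData` duplicates the one-line
`Literature.Probability.Percolation.dobrushinData` (outline-sanctioned; importing the CritPerc statement file would
drag the triangular-lattice preludes into this file).
-/

noncomputable section

open MeasureTheory Filter Topology
open scoped NNReal ENNReal
open Literature.Probability.LatticeModels Literature.Probability.Percolation

namespace Literature.Probability.LatticeModels

/-! ### Canonical Dobrushin data -/

/-- The canonical G02 discrete Dobrushin data of the Dobrushin domain `(D; a, b)` at mesh `δ`:
domain `D.carrier`, mesh `δ`, `+`/wired arc `A = (ab) = D.arc 0`, `−`/free arc
`B = (ba) = D.arc 1`. One candidate discretisation of `(D; a, b)` (see `IsDiscretisation` for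
the hypotheses the S17 statements actually consume). (CDHKS, C. R. Math. 352 (2014), §1;
Smirnov, Ann. Math. 172 (2010), §2.) [folklore] -/
def dobrushinData (D : RandomPlanarGeometry.DobrushinDomain) (δ : ℝ) : DiscreteDobrushin :=
  ⟨D.carrier, δ, D.arc 0, D.arc 1⟩

/-- The domain of `dobrushinData D δ` is `D.carrier`. (CDHKS 2014, §1.) [cite: CDHKSCRAS2014, §1] -/
@[simp] theorem dobrushinData_Ω (D : RandomPlanarGeometry.DobrushinDomain) (δ : ℝ) : (dobrushinData D δ).Ω = D.carrier :=
  rfl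

/-- The mesh of `dobrushinData D δ` is `δ`. (CDHKS 2014, §1.) [cite: CDHKSCRAS2014, §1] -/
@[simp] theorem dobrushinData_δ (D : RandomPlanarGeometry.DobrushinDomain) (δ : ℝ) : (dobrushinData D δ).δ = δ := rfl

/-- The `+`/wired arc of `dobrushinData D δ` is `(ab) = D.arc 0`. (CDHKS 2014, §1.)
[cite: CDHKSCRAS2014, §1] -/
@[simp] theorem dobrushinData_arcA (D : RandomPlanarGeometry.DobrushinDomain) (δ : ℝ) :
    (dobrushinData D δ).arcA = D.arc 0 := rfl

/-- The `−`/free arc of `dobrushinData D δ` is `(ba) = D.arc 1`. (CDHKS 2014, §1.)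
[cite: CDHKSCRAS2014, §1] -/
@[simp] theorem dobrushinData_arcB (D : RandomPlanarGeometry.DobrushinDomain) (δ : ℝ) :
    (dobrushinData D δ).arcB = D.arc 1 := rfl

/-! ### Boundary spins and the two lattice measures of discrete Dobrushin data -/

/-- The Dobrushin `±` boundary spins of the discrete Dobrushin data `E`: `+1` exactly on G02's
discrete arc `E.zdArcA` (sites of the polygonal boundary `E.zdBoundary` closest to the arc `A`),
`−1` elsewhere — in particular on `E.zdArcB` and, harmlessly, at the (edgeless) sites outside
`Ω_δ`. Under `E.IsZdAdmissible` the polygonal boundary is `zdBoundary = zdArcA ⊔ zdArcB`, so a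
configuration equal to `dobrushinBC E` on `zdBoundary` is read literally by
`DiscreteDobrushin.IsPlus`/`IsMinus` (`IsPlus σ x ↔ σ x = 1` at every site:
`isPlus_iff_eq_one` in `InterfaceSLEProofs.lean`); freezing it on `meshBoundary ⊆ zdBoundary`
only, as `isingDobrushinMeasure` does, is not enough (module docstring, "Misstated rendering of
Theorem 1"). (CDHKS 2014, §1: "`+` on `(ab)`, `−` on `(ba)`".) [cite: CDHKSCRAS2014, §1: " +  on  (ab] -/
def dobrushinBC (E : DiscreteDobrushin) : SpinConfig (Site 2) :=
  open scoped Classical in fun x => if x ∈ E.zdArcA then 1 else -1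

/-- On the discrete arc `A` the boundary spin is `+1`. (CDHKS 2014, §1.)
[cite: CDHKSCRAS2014, §1] -/
theorem dobrushinBC_of_mem {E : DiscreteDobrushin} {x : Site 2} (hx : x ∈ E.zdArcA) :
    dobrushinBC E x = 1 := by
  simp [dobrushinBC, hx]

/-- Off the discrete arc `A` (in particular on the discrete arc `B`) the boundary spin is `−1`.
(CDHKS 2014, §1.) [cite: CDHKSCRAS2014, §1] -/
theorem dobrushinBC_of_not_mem {E : DiscreteDobrushin} {x : Site 2} (hx : x ∉ E.zdArcA) :
    dobrushinBC E x = -1 := by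
  simp [dobrushinBC, hx]

/-- With the boundary spins `dobrushinBC E` imposed outside the free volume, a site of the
discrete arc `A` is `+` in G02's sense. (CDHKS 2014, §1.) [cite: CDHKSCRAS2014, §1] -/
theorem isPlus_dobrushinBC_of_mem (E : DiscreteDobrushin) {x : Site 2} (hx : x ∈ E.zdArcA) :
    E.IsPlus (dobrushinBC E) x :=
  Or.inl hx

/-- With the boundary spins `dobrushinBC E`, a site off the discrete arc `A` carrying its
boundary spin is `−` in G02's sense. (CDHKS 2014, §1.) [cite: CDHKSCRAS2014, §1] -/
theorem isMinus_dobrushinBC_of_not_mem (E : DiscreteDobrushin) {x : Site 2}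
    (hx : x ∉ E.zdArcA) : E.IsMinus (dobrushinBC E) x :=
  ⟨hx, Or.inr (dobrushinBC_of_not_mem hx)⟩

/-- The Ising measure of the discrete Dobrushin domain `E = (Ω_δ; A, B)` with `±` boundary
spins on the *vertex boundary*, at inverse temperature `β` and zero field: `isingMeasure` of the
graph `Ω_δ = discreteDomainGraph E.Ω E.δ` in the volume
`Ω_δ ∖ meshBoundary = meshInteriorFinset E.Ω E.δ`, all other spins (in particular those on
`meshBoundary E.Ω E.δ`) frozen to `dobrushinBC E` (`+` on `zdArcA`, `−` elsewhere). **Caveat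
(verdict clean-up 2026-08-16):** this volume still contains the sites of
`E.zdBoundary ∖ meshBoundary` (the concave lattice corners of `Ω_δ`), which G02's interface
predicates `IsPlus`/`IsMinus` read as frozen `±` boundary spins; the measure of CDHKS's model
(spins free exactly on the inner vertices of the polygonal domain, `±` on all of
`∂Ω^δ = zdBoundary`) is `Literature.Probability.LatticeModels.isingZdDobrushinMeasure`
(`InterfaceSLEProofs.lean`, volume `Ω_δ ∖ zdBoundary`), equal to this one when
`zdBoundary ⊆ meshBoundary` (`isingZdDobrushinMeasure_eq_isingDobrushinMeasure`). Kept as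
defined (it has users); see the module docstring, "Misstated rendering of Theorem 1". Junk for
unbounded `Ω` or `δ ≤ 0`: empty volume, the Dirac mass at the frozen configuration.
(Finite-volume Gibbs measure `μ^η_{Λ;β,h}`: Friedli–Velenik 2017, §3.1; the Dobrushin setting:
CDHKS 2014, §1.) [cite: FriedliVelenik2017, §3.1] -/
def isingDobrushinMeasure (E : DiscreteDobrushin) (β : ℝ) : Measure (SpinConfig (Site 2)) :=
  isingMeasure (discreteDomainGraph E.Ω E.δ) (meshInteriorFinset E.Ω E.δ) β 0
    (.fixed (dobrushinBC E))

/-- The Dobrushin Ising measure is a probability measure (for every `E`, `β`), from G02's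
`isingMeasure.instIsProbabilityMeasure`. (Friedli–Velenik 2017, §3.1.)
[cite: FriedliVelenik2017, §3.1] -/
instance isingDobrushinMeasure.instIsProbabilityMeasure (E : DiscreteDobrushin) (β : ℝ) :
    IsProbabilityMeasure (isingDobrushinMeasure E β) := by
  unfold isingDobrushinMeasure; infer_instance

/-- The critical FK-Ising (random-cluster, `q = 2`, `p = p_c = √2/(1+√2) = criticalFKIsingParam`)
measure of the discrete Dobrushin domain `E`, wired on the discrete arc `A` and dual-wired
(edges touching the discrete arc `B` deleted) on `B`: G02's `E.fkInterfaceMeasure p_c 2`, the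
measure under which `fkInterface E` has the law of Smirnov's FK Dobrushin interface; the
finiteness of `Ω_δ` is `meshDomain_finite`. Junk for unbounded `Ω` or `δ ≤ 0`: `Measure.dirac ∅`.
(CDHKS 2014, §1 and Thm 2; Smirnov, Ann. Math. 172 (2010), §2.1–2.2.)
[cite: CDHKSCRAS2014, §1 and Thm 2] -/
def fkDobrushinMeasure (E : DiscreteDobrushin) : Measure (BondConfig (Site 2)) :=
  open scoped Classical in
  if h : Bornology.IsBounded E.Ω ∧ 0 < E.δ then
    haveI : Fintype (meshDomain E.Ω E.δ) := (meshDomain_finite h.1 h.2).fintype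
    E.fkInterfaceMeasure criticalFKIsingParam 2
  else Measure.dirac ∅

/-- For bounded `Ω` and `δ > 0`, `fkDobrushinMeasure E` is G02's `fkInterfaceMeasure` at `p_c`,
`q = 2`, for the `Fintype` structure given by `meshDomain_finite`. (Smirnov 2010, §2.)
[cite: Smirnov2010, §2] -/
theorem fkDobrushinMeasure_of_pos (E : DiscreteDobrushin) (hΩ : Bornology.IsBounded E.Ω)
    (hδ : 0 < E.δ) :
    fkDobrushinMeasure E =
      @DiscreteDobrushin.fkInterfaceMeasure E (meshDomain_finite hΩ hδ).fintype
        criticalFKIsingParam 2 := by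
  simp [fkDobrushinMeasure, hΩ, hδ]

/-- The critical FK-Ising Dobrushin measure is a probability measure (`0 ≤ p_c ≤ 1`, `q = 2 > 0`,
`isProbabilityMeasure_fkInterfaceMeasure`; the junk branch is a Dirac mass).
(Grimmett, *The random-cluster model* (2006), §1.2.) [folklore] -/
instance fkDobrushinMeasure.instIsProbabilityMeasure (E : DiscreteDobrushin) :
    IsProbabilityMeasure (fkDobrushinMeasure E) := by
  by_cases h : Bornology.IsBounded E.Ω ∧ 0 < E.δ
  · rw [fkDobrushinMeasure_of_pos E h.1 h.2]
    exact @DiscreteDobrushin.isProbabilityMeasure_fkInterfaceMeasure E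
      (meshDomain_finite h.1 h.2).fintype _ _ criticalFKIsingParam_mem_Icc two_pos
  · unfold fkDobrushinMeasure
    rw [dif_neg h]
    infer_instance

/-! ### Interfaces as curves modulo reparametrisation -/

/-- Re-orient a list of points of the plane so that it runs from (near) `a = D.pt 0` to (near)
`b = D.pt 1`: keep the list if its head is at least as close to `a` as to `b`, reverse it
otherwise (`[]` stays `[]`). Needed because G02 orients interfaces by "arc `A` on the left" while
`MarkedDomain` does not fix the orientation of the boundary loop, whereas chordal SLE_κ in
`IsSLECurve κ D` runs from `a` to `b`. (CDHKS 2014, §1: interfaces "from `a` to `b`".)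
[cite: CDHKSCRAS2014, §1: interfaces "from  a  to  b "] -/
def orientChord (D : RandomPlanarGeometry.DobrushinDomain) : List ℂ → List ℂ
  | [] => []
  | z :: l => if dist z (D.pt 0) ≤ dist z (D.pt 1) then z :: l else (z :: l).reverse

/-- Re-orienting the empty list gives the empty list. (CDHKS 2014, §1.) [cite: CDHKSCRAS2014, §1] -/
@[simp] theorem orientChord_nil (D : RandomPlanarGeometry.DobrushinDomain) : orientChord D [] = [] := rfl

/-- `orientChord D l` is `l` or its reversal: re-orientation does not change the underlying set of
points, only (possibly) the direction of travel. (CDHKS 2014, §1.) [cite: CDHKSCRAS2014, §1] -/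
theorem orientChord_eq_self_or_reverse (D : RandomPlanarGeometry.DobrushinDomain) (l : List ℂ) :
    orientChord D l = l ∨ orientChord D l = l.reverse := by
  cases l with
  | nil => simp
  | cons z l => by_cases h : dist z (D.pt 0) ≤ dist z (D.pt 1) <;> simp [orientChord, h]

/-- A list whose head is at least as close to `a` as to `b` is already oriented from `a` to `b`.
(CDHKS 2014, §1.) [cite: CDHKSCRAS2014, §1] -/
theorem orientChord_of_le (D : RandomPlanarGeometry.DobrushinDomain) {z : ℂ} (l : List ℂ)
    (h : dist z (D.pt 0) ≤ dist z (D.pt 1)) : orientChord D (z :: l) = z :: l := by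
  simp [orientChord, h]

/-- The spin interface `γ` at mesh `δ` (a list of dual edges of `δℤ²`, faces indexed by
lower-left corners, as in `IsDobrushinInterface`) as a point of the curve space `CurveClass ℂ`:
the class of the polyline through the points `dualMedialPoint δ d`, `d ∈ γ` — the midpoints of
the true dual edges, i.e. (for adjacent faces) the midpoints of the crossed primal edges —
re-oriented from `a` to `b` (`orientChord`). Junk: the constant curve `0` for `γ = []`.
(CDHKS 2014, §1 and Thm 1; Grimmett 1999, §11.2 for the dual-lattice conventions.)
[cite: CDHKSCRAS2014, §1 and Thm 1] -/
def spinInterfaceCurve (D : RandomPlanarGeometry.DobrushinDomain) (δ : ℝ) (γ : List (Sym2 (Site 2))) : RandomPlanarGeometry.CurveClass ℂ :=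
  RandomPlanarGeometry.CurveClass.mk ⟨polyline (orientChord D (γ.map (dualMedialPoint δ)))⟩

/-- The FK-Ising interface of the bond configuration `ω` in the discrete Dobrushin domain `E`
(a discretisation of `(D; a, b)`) as a point of `CurveClass ℂ`: the class of the polyline
through the medial vertices (edge midpoints `medialPoint E.δ`) of G02's exploration path
`fkInterface E ω` (loop representation, wired arc `A` on one side, dual-wired `B` on the
other), re-oriented from `a` to `b` (`orientChord D`). Junk: the constant curve `0` when
`fkInterface` is the junk `[]`. (CDHKS 2014, §1 and Thm 2; Smirnov, Ann. Math. 172 (2010), §2.)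
[cite: CDHKSCRAS2014, §1 and Thm 2] -/
def fkInterfaceCurve (D : RandomPlanarGeometry.DobrushinDomain) (E : DiscreteDobrushin) (ω : BondConfig (Site 2)) :
    RandomPlanarGeometry.CurveClass ℂ :=
  RandomPlanarGeometry.CurveClass.mk ⟨polyline (orientChord D ((fkInterface E ω).map (medialPoint E.δ)))⟩

/-! ### Discretisations of a Dobrushin domain -/

/-- `IsDiscretisation D E`: the family `E δ` (`δ > 0`) of G02 discrete Dobrushin data
*discretises* the Dobrushin domain `(D; a, b)` in the sense of CDHKS's approximations
`(Ω_δ; a_δ, b_δ) → (Ω; a, b)`, specialised to the canonical vertex set: the domain is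
`D.carrier` (so `Ω_δ = meshDomain D.carrier δ`) and the mesh is `δ`; the two arcs of the data
converge to the boundary arcs `(ab) = D.arc 0`, `(ba) = D.arc 1` in the Hausdorff extended
distance (they are free otherwise, so that the tie sites of `discreteArc` can be avoided); the
discrete marked points — the midpoints of the `A`–`B` boundary edges `e_a`, `e_b`
(`DiscreteDobrushin.zdABEdges`) — converge to `{a, b}`; and the data are admissible
(`IsZdAdmissible`: disjoint discrete arcs covering `∂Ω_δ`, exactly two `A`–`B` edges, …) for
all small `δ > 0`, so that G02's `fkInterface` and `IsDobrushinInterface` are not junk. See the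
module docstring for a caveat on the satisfiability of G02's `IsZdAdmissible`.
(CDHKS 2014, §1; Chelkak–Smirnov, Invent. Math. 189 (2012), §3.2 for discrete domains
approximating a continuum one.) [cite: CDHKSCRAS2014, §1] -/
structure IsDiscretisation (D : RandomPlanarGeometry.DobrushinDomain) (E : ℝ → DiscreteDobrushin) : Prop where
  /-- The domain of the data at every mesh is `D`. -/
  Ω_eq : ∀ δ, (E δ).Ω = D.carrier
  /-- The mesh of the data at mesh `δ` is `δ`. -/
  δ_eq : ∀ δ, (E δ).δ = δ
  /-- The `+`/wired arcs converge to `(ab)` in Hausdorff distance. -/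
  tendsto_arcA :
    Tendsto (fun δ => Metric.hausdorffEDist (E δ).arcA (D.arc 0)) (𝓝[>] 0) (𝓝 0)
  /-- The `−`/free arcs converge to `(ba)` in Hausdorff distance. -/
  tendsto_arcB :
    Tendsto (fun δ => Metric.hausdorffEDist (E δ).arcB (D.arc 1)) (𝓝[>] 0) (𝓝 0)
  /-- The discrete marked points `a_δ`, `b_δ` (midpoints of the `A`–`B` edges) converge to
  `{a, b}` in Hausdorff distance. -/
  tendsto_zdABEdges :
    Tendsto (fun δ => Metric.hausdorffEDist (medialPoint δ '' (E δ).zdABEdges) {D.pt 0, D.pt 1})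
      (𝓝[>] 0) (𝓝 0)
  /-- The data are admissible for all small positive meshes. -/
  eventually_isZdAdmissible : ∀ᶠ δ in 𝓝[>] (0 : ℝ), (E δ).IsZdAdmissible

namespace IsDiscretisation

variable {D : RandomPlanarGeometry.DobrushinDomain} {E : ℝ → DiscreteDobrushin}

/-- For a discretisation, the discrete domain at mesh `δ` is the canonical `meshDomain D δ`.
(Chelkak–Smirnov 2012, §3.2.) [cite: ChelkakSmirnov2012, §3.2] -/
theorem meshDomain_eq (h : IsDiscretisation D E) (δ : ℝ) :
    meshDomain (E δ).Ω (E δ).δ = meshDomain D.carrier δ := by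
  rw [h.Ω_eq, h.δ_eq]

/-- For a discretisation and `δ > 0`, the FK Dobrushin measure is the genuine
`fkInterfaceMeasure` (not the junk branch). (Smirnov 2010, §2.) [cite: Smirnov2010, §2] -/
theorem fkDobrushinMeasure_eq (h : IsDiscretisation D E) {δ : ℝ} (hδ : 0 < δ) :
    fkDobrushinMeasure (E δ) =
      @DiscreteDobrushin.fkInterfaceMeasure (E δ)
        (meshDomain_finite ((h.Ω_eq δ).symm ▸ D.isBounded) ((h.δ_eq δ).symm ▸ hδ)).fintype
        criticalFKIsingParam 2 :=
  fkDobrushinMeasure_of_pos (E δ) ((h.Ω_eq δ).symm ▸ D.isBounded) ((h.δ_eq δ).symm ▸ hδ)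

end IsDiscretisation

/-! ### crit-ising.S17: convergence of critical Ising interfaces to SLE -/

/-- **Deprecated — misstated rendering** of CDHKS Theorem 1 (spin-Ising interfaces converge to
SLE₃; provefact verdict `misstated`; verdict clean-up 2026-08-16; details and sources in the
module docstring, section "Misstated rendering of Theorem 1"). **What is wrong:** the statement
samples the configuration from `isingDobrushinMeasure (E δ) β_c`, whose free volume
`Ω_δ ∖ meshBoundary` contains the concave lattice corners of `Ω_δ` (sites of G02's polygonal
boundary `zdBoundary` that are not in the vertex boundary `meshBoundary`; present in every
discretised curved Jordan domain at all small meshes), while the curves it speaks about are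
constrained only through `IsInterfaceSelection` → `IsDobrushinInterface` →
`DiscreteDobrushin.IsPlus`/`IsMinus`, which read every site of
`zdArcA ⊔ zdArcB = zdBoundary` (admissibility) as a frozen `±` spin. The selected curve is thus
a domain wall of the configuration overridden to `±` on `zdBoundary` — an interface of a model
with thermal corner spins read as frozen — and not the interface "generated by the Dobrushin
boundary conditions" on `∂Ω^δ` of the sampled critical Ising model (CDHKS 2014, §1; spins free
exactly on `Int Ω^δ`, Chelkak–Smirnov 2012, §2.2.1), which is what Theorem 1 is about. (A
second, milder divergence: it quantifies over all, possibly non-local, interface-selection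
rules, where CDHKS fix the leftmost/rightmost interface with arbitrary local turning.)
**Corrected statement — use instead:**
`Literature.Probability.LatticeModels.convergesInLawToSLE_three_isingInterface_zd`
(`InterfaceSLEProofs.lean`, [CDHKSCRAS2014, Thm. 1]: measure `isingZdDobrushinMeasure`, free
volume `Ω_δ ∖ zdBoundary`; the leftmost interface `leftmostInterface`). It is deliberately not
re-declared here: its file imports this one (a re-declaration would be a duplicate, and for the
same reason the attribute below names it in its message rather than as an identifier). No
`…_holds` of the present def is to be expected; its one Lean-level user is the instance
`convergesInLawToSLE_isingInterface_unitDisc` (`UnitDiscDiscretisation.lean`).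
Original description (of the unchanged statement): let `(D; a, b)` be a Jordan domain with two
marked boundary points and let `(Ω_δ; a_δ, b_δ) = E δ` be admissible square-lattice Dobrushin
discretisations of it (`IsDiscretisation D E`). Consider the Ising model at
`β = β_c = ½ log (1 + √2)`, `h = 0` on `Ω_δ` under `isingDobrushinMeasure` (boundary spins `+`
on the discrete arc `(a_δ b_δ)`, `−` elsewhere, imposed off `Ω_δ ∖ meshBoundary`), and let
`sel δ` be any interface-selection rule (`IsInterfaceSelection`) choosing, for every spin
configuration admitting a Dobrushin interface, one of its interfaces. Then the selected curve,
as a random curve modulo reparametrisation, converges in law to chordal SLE₃ in `D` from `a` to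
`b` as `δ → 0⁺`. (Chelkak–Duminil-Copin–Hongler–Kemppainen–Smirnov, C. R. Math. Acad. Sci.
Paris 352 (2014) 157, Theorem 1 — of which this is the misstated rendering.)
[cite: CDHKSCRAS2014, Thm. 1 (misstated rendering — free volume Ω_δ ∖ meshBoundary instead of Ω_δ ∖ zdBoundary — deprecated; corrected statement convergesInLawToSLE_three_isingInterface_zd, InterfaceSLEProofs.lean)] -/
@[deprecated "misstated rendering of CDHKS 2014, Theorem 1 (the measure `isingDobrushinMeasure` frees the spins on `Ω_δ ∖ meshBoundary`, which contains the concave lattice corners of `Ω_δ`, sites of `zdBoundary = zdArcA ⊔ zdArcB` that the interface predicate `IsDobrushinInterface` reads as frozen `±` boundary spins — so the curve is not an interface of the sampled CDHKS model): use Literature.Probability.LatticeModels.convergesInLawToSLE_three_isingInterface_zd (InterfaceSLEProofs.lean: measure isingZdDobrushinMeasure, free volume Ω_δ ∖ zdBoundary, leftmost interface)" (since := "2026-08-16")]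
def convergesInLawToSLE_three_isingInterface : Prop :=
  ∀ (D : RandomPlanarGeometry.DobrushinDomain) (E : ℝ → DiscreteDobrushin) (_hE : IsDiscretisation D E)
    (sel : ℝ → SpinConfig (Site 2) → List (Sym2 (Site 2)))
    (_hsel : ∀ δ, IsInterfaceSelection (E δ) (sel δ)),
    RandomPlanarGeometry.ConvergesInLawToSLE 3 D (Ωδ := fun _ => SpinConfig (Site 2))
      (fun δ σ => spinInterfaceCurve D δ (sel δ σ))
      (fun δ => isingDobrushinMeasure (E δ) criticalBetaTwo)

/-- **crit-ising.S17** (FK-Ising interfaces converge to SLE_{16/3}; Chelkak–Duminil-Copin–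
Hongler–Kemppainen–Smirnov, C. R. Math. Acad. Sci. Paris 352 (2014) 157, Theorem 2; Smirnov,
Ann. Math. 172 (2010) 1435). Let `(D; a, b)` be a Jordan domain with two marked boundary points
and let `(Ω_δ; a_δ, b_δ) = E δ` be admissible square-lattice Dobrushin discretisations of it
(`IsDiscretisation D E`). For the critical FK-Ising random-cluster model (`q = 2`,
`p = p_c = √2 / (1 + √2)`) on `Ω_δ`, wired on `(a_δ b_δ)` and dual-wired on `(b_δ a_δ)`
(`fkDobrushinMeasure`), the interface between the open cluster of `(a_δ b_δ)` and the dual-open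
cluster of `(b_δ a_δ)`, as a random curve modulo reparametrisation, converges in law to chordal
SLE_{16/3} in `D` from `a` to `b` as `δ → 0⁺`. Named fact (not proved here).
[cite: CDHKSCRAS2014, Thm. 2] -/
def convergesInLawToSLE_sixteen_thirds_fkInterface : Prop :=
  ∀ (D : RandomPlanarGeometry.DobrushinDomain) (E : ℝ → DiscreteDobrushin) (_hE : IsDiscretisation D E),
    RandomPlanarGeometry.ConvergesInLawToSLE (16 / 3) D (Ωδ := fun _ => BondConfig (Site 2))
      (fun δ => fkInterfaceCurve D (E δ)) (fun δ => fkDobrushinMeasure (E δ))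

end Literature.Probability.LatticeModels
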